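import Summits.HubbardSuperconductivity.HubbardSuperconductivity.Theorems.KLProgrammeKLRegimeScaleZeroRecordPairWindow

/-!
# Route `KLProgramme`, crux K3 — ENGINE (stmt-HubbardSuperconductivity-20437), row (C) `stub_twoLeg_curvature`: the scale-`0` pair at DEDICATED record-level tables
# («(C)-FIRST-STEP-FIT» cure (ii), pen (R549)(4); cell gate-hubbard-kl, seat p2 g28)

WHY.  The (C) closer's package keys the first flow step (`m = 0`, `d = 128`) on the SAME scale-uniform private table `cc` that must dominate every later
reading; with the `d = 128` record this is infeasible for natural data (`firstStep_slopeKeyed_table128r_contra`, …EngineV17F2RowCFirstStep; memo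
`HOME/p2-g28/FIRST-STEP-FIT.md`).  The cure re-keys the first step on a DEDICATED scale-`0` table read off the #22a/#22b records themselves.  k3c5-p1 g20's
chain (…ScaleZeroRecordPairRegistered/CertA/Window) books the scale-`0` pair at the REGISTERED ceilings (`klC4aJetC2`, `klC4aJetC′ P R`, `klReadOscC P R`) through
four numeric fits; THIS FILE books the same pair, from the same record hypotheses, at the record-level table
  `cD = (5, 3.19·B₁ + δ_A, 3.19²·B₂ + 24.12·B₁ + δ_A, sS₃ + δ_A, sS₄ + δ_A)`, `cD′ = (2⁵², 0, …)`, oscillation constant `2⁵³`,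
where `B₁, B₂` bound the bundles' certified sunset moments `b.bS 1, b.bS 2` over the chain and `δ_A = (1 + 3.19 + 24.12 + 240 + 7430)⁴/10⁷⁸ < 10⁻⁶²`:
* `twoLegRead_frameZero_dedicated_of_records_certA` — pointwise form (one level `μ`, record rows `hS12`/`hSjet`, `bS 1 ≤ B 1`, `bS 2 ≤ B 2`);
* **`twoLegRead_frameZero_dedicated_klEngGQ_of_chain_certA`** — under the (C) closer's literal prefix, from the chain of bundles (`hB : ∀ b ∈ l, b.bS 1 ≤ B 1 ∧ b.bS 2 ≤ B 2`
  in place of `hfit12`; no `hfit34`): `TwoLegReadJetBound L M cD cD′ β U μ (K₀) 0 ∧ TwoLegReadOscAt L M 2⁵³ β U μ (K₀) 0`.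
FIRST-STEP READING (memo §2/§4): with the (C1) input of the first step keyed on `cD` (slope form, `a 0 = (π/2)·cD 1`) the first step closes iff
`cD 1 = 3.19·B₁ + δ_A ≲ 0.27`, i.e. the records certify `B₁ ≲ 0.085` (natural ≈ 0.016); the oscillation constant of this chain (`2⁵³`) is too crude for the
osc-keyed form, which is therefore not the route.  Proofs only; no definitions; the record rows/certificates are HYPOTHESES (kit records, FROZEN); nothing here
asserts (C), any stub of 20437, K3, U₀, the window or superconductivity.  0 kit · 0 lit.
References: BGM 2006 §2.3–§2.4 Lemma 2.1 (2.36)–(2.42), §3 (3.2)–(3.3) [cite: BenfattoGiulianiMastropietro2006].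
-/

noncomputable section

namespace Summit.HubbardSuperconductivity.HubbardSuperconductivity.Theorems.KLRegimeSplit

set_option linter.dupNamespace false -- summit = problem name (single-conjunct summit), D-0017
set_option exponentiation.threshold 4096 -- `klTailBookU = 10⁻³⁰⁰` bookkeeping

open Real Finset Complex Literature.MathematicalPhysics.QuantumLattice Literature.Probability.LatticeModels GrassmannAlgebra Matrix
open Literature.MathematicalPhysics.QuantumLattice.FermiRG Literature.Probability.LatticeModels.BattleFederbush
open Summit.HubbardSuperconductivity.HubbardSuperconductivity.Theorems.KLProgrammeLegKernels
open Summit.HubbardSuperconductivity.HubbardSuperconductivity.Theorems.TwoLegFourier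
open Summit.HubbardSuperconductivity.HubbardSuperconductivity.Theorems.EngineV8
open Summit.HubbardSuperconductivity.HubbardSuperconductivity.Theorems.PerturbedFermiCurve
open Summit.HubbardSuperconductivity.HubbardSuperconductivity.Theorems.DispersionFlow
open scoped Nat

variable {L M : ℕ} [NeZero L] [NeZero M] {μ U β : ℝ}

/-! ## §1 Pointwise: the scale-`0` pair at the record-level table `cD(B, sS)` -/

/-- **THE SCALE-0 PAIR AT THE DEDICATED RECORD-LEVEL TABLE** (one level `μ ∈ klWindowC`, `0 < U ≤ klTailBookU`, `klBetaMin ≤ β`, `klEngL₃ β U ≤ L`,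
`klEngM₃ β U L ≤ M`): from `KlwjCertA`, the #22a rows `hS12`, the #22b rows `hSjet` and table bounds `bS 1 ≤ B 1`, `bS 2 ≤ B 2`:
`TwoLegReadJetBound L M cD cD′ β U μ (K₀) 0 ∧ TwoLegReadOscAt L M 2⁵³ β U μ (K₀) 0`. [cite: BenfattoGiulianiMastropietro2006, §2.4 Lemma 2.1 (2.36)–(2.42)] -/
theorem twoLegRead_frameZero_dedicated_of_records_certA (hA : KlwjCertA) (hβ : klBetaMin ≤ β) (hμ : μ ∈ klWindowC)
    (hU : 0 < U) (hUb : U ≤ klTailBookU) (hL : klEngL₃ β U ≤ L) (hM : klEngM₃ β U L ≤ M) {bS sS B : ℕ → ℝ}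
    (hS12 : ∀ k, 1 ≤ k → k ≤ 2 → ∀ (σ : Fin 2) (p₀ : GridPoint L (2 * (2 * M))), ∑ p₁ : GridPoint L (2 * (2 * M)),
      (if p₁ = p₀ then (0 : ℝ) else
        Real.sqrt ((((p₁.2 - p₀.2) 0).valMinAbs.natAbs : ℝ) ^ 2 + (((p₁.2 - p₀.2) 1).valMinAbs.natAbs : ℝ) ^ 2) ^ k * ‖contr ℂ ((hubbardGridSub L M β (2 * (2 * M))).transpose * hubbardCovAboveCT L M β μ 0 0 klE0 *
                hubbardGridSub L M β (2 * (2 * M))) (((p₁, σ), 0) : GridLeg (GridPoint L (2 * (2 * M)))) ((p₀, σ), 1) *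
              (contr ℂ ((hubbardGridSub L M β (2 * (2 * M))).transpose * hubbardCovAboveCT L M β μ 0 0 klE0 *
                hubbardGridSub L M β (2 * (2 * M))) (((p₀, σ.rev), 0) : GridLeg (GridPoint L (2 * (2 * M)))) ((p₁, σ.rev), 1) *
                contr ℂ ((hubbardGridSub L M β (2 * (2 * M))).transpose * hubbardCovAboveCT L M β μ 0 0 klE0 *
                hubbardGridSub L M β (2 * (2 * M))) (((p₁, σ.rev), 0) : GridLeg (GridPoint L (2 * (2 * M)))) ((p₀, σ.rev), 1))‖) ≤
        bS k * (((2 * (2 * M) : ℕ) : ℝ) / β))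
    (hSjet : ∀ k, 3 ≤ k → k ≤ 4 → ∀ θ : ℝ, |iteratedDeriv k (fun θ : ℝ => evalM (symInterp L (fun pp : TorusSite 2 L =>
        (∑ σσ : Fin 2, ((selfEnergy L M β (ExteriorAlgebra.map (Matrix.toLin' (gridSubMatrix L M β
            (fun p : GridPoint L (2 * (2 * M)) => p.2) (fun p => gridTime β (2 * (2 * M)) p.1)))
          (∑ p' : GridPoint L (2 * (2 * M)), ∑ q' : GridPoint L (2 * (2 * M)), ∑ σ' : Fin 2,
          (if p' = q' then (0 : ℂ) else
            -((((U * (β / (2 * (2 * M) : ℕ)) : ℝ) : ℂ) ^ 2 *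
              (contr ℂ ((hubbardGridSub L M β (2 * (2 * M))).transpose * hubbardCovAboveCT L M β μ 0 0 klE0 *
                  hubbardGridSub L M β (2 * (2 * M))) (((q', σ'), 0) : GridLeg (GridPoint L (2 * (2 * M)))) ((p', σ'), 1) *
                (contr ℂ ((hubbardGridSub L M β (2 * (2 * M))).transpose * hubbardCovAboveCT L M β μ 0 0 klE0 *
                    hubbardGridSub L M β (2 * (2 * M))) (((p', σ'.rev), 0) : GridLeg (GridPoint L (2 * (2 * M)))) ((q', σ'.rev), 1) *
                  contr ℂ ((hubbardGridSub L M β (2 * (2 * M))).transpose * hubbardCovAboveCT L M β μ 0 0 klE0 *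
                    hubbardGridSub L M β (2 * (2 * M))) (((q', σ'.rev), 0) : GridLeg (GridPoint L (2 * (2 * M)))) ((p', σ'.rev), 1)))))) •
            (gen ℂ (((p', σ'), 0) : GridLeg (GridPoint L (2 * (2 * M)))) * gen ℂ (((q', σ'), 1) : GridLeg (GridPoint L (2 * (2 * M))))))) (omega0 M, pp) σσ).re +
        (selfEnergy L M β (ExteriorAlgebra.map (Matrix.toLin' (gridSubMatrix L M β
            (fun p : GridPoint L (2 * (2 * M)) => p.2) (fun p => gridTime β (2 * (2 * M)) p.1)))
          (∑ p' : GridPoint L (2 * (2 * M)), ∑ q' : GridPoint L (2 * (2 * M)), ∑ σ' : Fin 2,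
          (if p' = q' then (0 : ℂ) else
            -((((U * (β / (2 * (2 * M) : ℕ)) : ℝ) : ℂ) ^ 2 *
              (contr ℂ ((hubbardGridSub L M β (2 * (2 * M))).transpose * hubbardCovAboveCT L M β μ 0 0 klE0 *
                  hubbardGridSub L M β (2 * (2 * M))) (((q', σ'), 0) : GridLeg (GridPoint L (2 * (2 * M)))) ((p', σ'), 1) *
                (contr ℂ ((hubbardGridSub L M β (2 * (2 * M))).transpose * hubbardCovAboveCT L M β μ 0 0 klE0 *
                    hubbardGridSub L M β (2 * (2 * M))) (((p', σ'.rev), 0) : GridLeg (GridPoint L (2 * (2 * M)))) ((q', σ'.rev), 1) *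
                  contr ℂ ((hubbardGridSub L M β (2 * (2 * M))).transpose * hubbardCovAboveCT L M β μ 0 0 klE0 *
                    hubbardGridSub L M β (2 * (2 * M))) (((q', σ'.rev), 0) : GridLeg (GridPoint L (2 * (2 * M)))) ((p', σ'.rev), 1)))))) •
            (gen ℂ (((p', σ'), 0) : GridLeg (GridPoint L (2 * (2 * M)))) * gen ℂ (((q', σ'), 1) : GridLeg (GridPoint L (2 * (2 * M))))))) ((omega0 M).rev, pp) σσ).re)) / 4))
        (WithLp.toLp 2 (klFermiPoint μ 0 θ))) θ| ≤ sS k * U ^ 2)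
    (hB1 : bS 1 ≤ B 1) (hB2 : bS 2 ≤ B 2) :
    TwoLegReadJetBound L M
        (fun k => if k = 0 then 5 else if k = 1 then B 1 * ((319 : ℝ) / 100) + (1 + (319 : ℝ) / 100 + 2412 / 100 + 240 + 7430) ^ 4 / (10 : ℝ) ^ 78
          else if k = 2 then B 2 * ((319 : ℝ) / 100) ^ 2 + B 1 * ((2412 : ℝ) / 100) + (1 + (319 : ℝ) / 100 + 2412 / 100 + 240 + 7430) ^ 4 / (10 : ℝ) ^ 78
          else if k = 3 then sS 3 + (1 + (319 : ℝ) / 100 + 2412 / 100 + 240 + 7430) ^ 4 / (10 : ℝ) ^ 78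
          else if k = 4 then sS 4 + (1 + (319 : ℝ) / 100 + 2412 / 100 + 240 + 7430) ^ 4 / (10 : ℝ) ^ 78 else 0)
        (fun k => if k = 0 then (2 : ℝ) ^ 52 else 0) β U μ (klFlowFrameU L M β U μ 0) 0 ∧
      TwoLegReadOscAt L M ((2 : ℝ) ^ 53) β U μ (klFlowFrameU L M β U μ 0) 0 := by
  have hD := fun θ => freeFermiPointLp_sizes_of_klwjCertA (μ := μ) hA hμ θ
  obtain ⟨hJ, hO⟩ := twoLegRead_frameZero_private_of_records (L := L) (M := M) hβ hμ hU hUb hL hM hS12 hSjet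
    (D := fun i => if i = 1 then (319 : ℝ) / 100 else if i = 2 then (2412 : ℝ) / 100 else if i = 3 then 240 else 7430) (fun θ i hi1 hi4 => by
      interval_cases i
      · exact (hD θ).1
      · exact (hD θ).2.1
      · exact (hD θ).2.2.1
      · exact (hD θ).2.2.2)
  refine ⟨hJ.mono (fun k => ?_) (fun k => le_rfl), hO⟩
  rcases Nat.lt_or_ge k 5 with hk5 | hk5
  · interval_cases k <;> norm_num <;> nlinarith [hB1, hB2]
  · rw [if_neg (by omega), if_neg (by omega), if_neg (by omega), if_neg (by omega), if_neg (by omega),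
      if_neg (by omega), if_neg (by omega), if_neg (by omega), if_neg (by omega), if_neg (by omega)]

/-! ## §2 Under the (C) closer's prefix, from the chain of bundles -/

/-- **THE DEDICATED SCALE-0 PAIR UNDER THE (C) CLOSER'S PREFIX, FROM THE CHAIN** (cure (ii) of «(C)-FIRST-STEP-FIT»): the hypotheses of
`twoLegRead_frameZero_registered_klEngGQ_of_chain_certA` with the numeric fits `hfit12`/`hfit34` REPLACED by table bounds
`hB : ∀ b ∈ l, b.bS 1 ≤ B 1 ∧ b.bS 2 ≤ B 2`; conclusion at `cD(B, sS)`, `cD′ = (2⁵², 0, …)`, oscillation `2⁵³`. [cite: BenfattoGiulianiMastropietro2006, §2.4 Lemma 2.1 (2.36)–(2.42)] -/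
theorem twoLegRead_frameZero_dedicated_klEngGQ_of_chain_certA (G : GeoConsts) (Q : EngConsts) (hA : KlwjCertA)
    (l : List SunsetCellBundle) (rs : SunsetFarSupRecord) (ω₁ u₀ u₂ : ℚ)
    (hne : l.map (fun b => (b.c.μlo, b.c.μhi)) ≠ [])
    (hhead : ∀ c ∈ (l.map (fun b => (b.c.μlo, b.c.μhi))).head?, c.1 ≤ (-21) / 20)
    (hlast : ∀ c ∈ (l.map (fun b => (b.c.μlo, b.c.μhi))).getLast?, (-3) / 20 ≤ c.2)
    (hchain : (l.map (fun b => (b.c.μlo, b.c.μhi))).IsChain (fun c d => d.1 ≤ c.2))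
    (hc : ∀ b ∈ l, ScaleZeroSunsetCertV3 b.c) (hr : ∀ b ∈ l, ScaleZeroFarGapCert b.c.toSunsetCellRecordV2 b.r)
    (hrs : ∀ b ∈ l, ScaleZeroFarSupCert b.c.toSunsetCellRecordV2 rs) (hside : ∀ b ∈ l, b.SideOK3 rs ω₁ u₀ u₂)
    {B : ℕ → ℝ} (hB : ∀ b ∈ l, ((b.bS 1 : ℚ) : ℝ) ≤ B 1 ∧ ((b.bS 2 : ℚ) : ℝ) ≤ B 2)
    {sS : ℕ → ℝ}
    (hSjetW : ∀ (μ U β : ℝ) (L M : ℕ) [NeZero L] [NeZero M], μ ∈ klWindowC → 0 < U → U ≤ klTailBookU → klBetaMin ≤ β →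
      klEngL₃ β U ≤ L → klEngM₃ β U L ≤ M →
      ∀ k, 3 ≤ k → k ≤ 4 → ∀ θ : ℝ, |iteratedDeriv k (fun θ : ℝ => evalM (symInterp L (fun pp : TorusSite 2 L =>
          (∑ σσ : Fin 2, ((selfEnergy L M β (ExteriorAlgebra.map (Matrix.toLin' (gridSubMatrix L M β
              (fun p : GridPoint L (2 * (2 * M)) => p.2) (fun p => gridTime β (2 * (2 * M)) p.1)))
            (∑ p' : GridPoint L (2 * (2 * M)), ∑ q' : GridPoint L (2 * (2 * M)), ∑ σ' : Fin 2,
            (if p' = q' then (0 : ℂ) else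
              -((((U * (β / (2 * (2 * M) : ℕ)) : ℝ) : ℂ) ^ 2 *
                (contr ℂ ((hubbardGridSub L M β (2 * (2 * M))).transpose * hubbardCovAboveCT L M β μ 0 0 klE0 *
                    hubbardGridSub L M β (2 * (2 * M))) (((q', σ'), 0) : GridLeg (GridPoint L (2 * (2 * M)))) ((p', σ'), 1) *
                  (contr ℂ ((hubbardGridSub L M β (2 * (2 * M))).transpose * hubbardCovAboveCT L M β μ 0 0 klE0 *
                      hubbardGridSub L M β (2 * (2 * M))) (((p', σ'.rev), 0) : GridLeg (GridPoint L (2 * (2 * M)))) ((q', σ'.rev), 1) *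
                    contr ℂ ((hubbardGridSub L M β (2 * (2 * M))).transpose * hubbardCovAboveCT L M β μ 0 0 klE0 *
                      hubbardGridSub L M β (2 * (2 * M))) (((q', σ'.rev), 0) : GridLeg (GridPoint L (2 * (2 * M)))) ((p', σ'.rev), 1)))))) •
              (gen ℂ (((p', σ'), 0) : GridLeg (GridPoint L (2 * (2 * M)))) * gen ℂ (((q', σ'), 1) : GridLeg (GridPoint L (2 * (2 * M))))))) (omega0 M, pp) σσ).re +
          (selfEnergy L M β (ExteriorAlgebra.map (Matrix.toLin' (gridSubMatrix L M β
              (fun p : GridPoint L (2 * (2 * M)) => p.2) (fun p => gridTime β (2 * (2 * M)) p.1)))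
            (∑ p' : GridPoint L (2 * (2 * M)), ∑ q' : GridPoint L (2 * (2 * M)), ∑ σ' : Fin 2,
            (if p' = q' then (0 : ℂ) else
              -((((U * (β / (2 * (2 * M) : ℕ)) : ℝ) : ℂ) ^ 2 *
                (contr ℂ ((hubbardGridSub L M β (2 * (2 * M))).transpose * hubbardCovAboveCT L M β μ 0 0 klE0 *
                    hubbardGridSub L M β (2 * (2 * M))) (((q', σ'), 0) : GridLeg (GridPoint L (2 * (2 * M)))) ((p', σ'), 1) *
                  (contr ℂ ((hubbardGridSub L M β (2 * (2 * M))).transpose * hubbardCovAboveCT L M β μ 0 0 klE0 *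
                      hubbardGridSub L M β (2 * (2 * M))) (((p', σ'.rev), 0) : GridLeg (GridPoint L (2 * (2 * M)))) ((q', σ'.rev), 1) *
                    contr ℂ ((hubbardGridSub L M β (2 * (2 * M))).transpose * hubbardCovAboveCT L M β μ 0 0 klE0 *
                      hubbardGridSub L M β (2 * (2 * M))) (((q', σ'.rev), 0) : GridLeg (GridPoint L (2 * (2 * M)))) ((p', σ'.rev), 1)))))) •
              (gen ℂ (((p', σ'), 0) : GridLeg (GridPoint L (2 * (2 * M)))) * gen ℂ (((q', σ'), 1) : GridLeg (GridPoint L (2 * (2 * M))))))) ((omega0 M).rev, pp) σσ).re)) / 4))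
          (WithLp.toLp 2 (klFermiPoint μ 0 θ))) θ| ≤ sS k * U ^ 2) :
    ∀ (P : SplitConsts) (R : RenConsts) (c : ℝ), P.WF → R.WF2 → 0 < c → c ≤ klEngC₃7GU G P R →
      ∀ μ ∈ klWindowC, ∀ U : ℝ, 0 < U → U ≤ klEngU₀12GQ G Q P R c → ∀ β : ℝ, klBetaMin ≤ β → β ≤ Real.exp (c / U ^ 2) →
        ∀ (L M : ℕ) [NeZero L] [NeZero M], klEngL₄ P R β U ≤ L → klEngM₃ β U L ≤ M →
          TwoLegReadJetBound L M
              (fun k => if k = 0 then 5 else if k = 1 then B 1 * ((319 : ℝ) / 100) + (1 + (319 : ℝ) / 100 + 2412 / 100 + 240 + 7430) ^ 4 / (10 : ℝ) ^ 78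
          else if k = 2 then B 2 * ((319 : ℝ) / 100) ^ 2 + B 1 * ((2412 : ℝ) / 100) + (1 + (319 : ℝ) / 100 + 2412 / 100 + 240 + 7430) ^ 4 / (10 : ℝ) ^ 78
          else if k = 3 then sS 3 + (1 + (319 : ℝ) / 100 + 2412 / 100 + 240 + 7430) ^ 4 / (10 : ℝ) ^ 78
          else if k = 4 then sS 4 + (1 + (319 : ℝ) / 100 + 2412 / 100 + 240 + 7430) ^ 4 / (10 : ℝ) ^ 78 else 0)
              (fun k => if k = 0 then (2 : ℝ) ^ 52 else 0) β U μ (klFlowFrameU L M β U μ 0) 0 ∧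
            TwoLegReadOscAt L M ((2 : ℝ) ^ 53) β U μ (klFlowFrameU L M β U μ 0) 0 := by
  intro P R c _ _ _ _ μ hμ U hU hU12 β hβ _ L M _ _ hL hM
  have hUb : U ≤ klTailBookU := hU12.trans (klEngU₀12GQ_le_klTailBookU G Q P R c)
  have hL3 : klEngL₃ β U ≤ L := klEngL₃_le_of_klEngL₄_le hL
  obtain ⟨b, hb, -, -, hSk⟩ := sunsetRows_window_innerGap_of_chain (L := L) (M := M) l rs ω₁ u₀ u₂ hne hhead hlast hchain hc hr hrs hside hμ hβ hU
    (hUb.trans klTailBookU_le_half_pow_twenty) hL3 hM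
  have e1 : b.bSℝ 1 = ((b.bS 1 : ℚ) : ℝ) := SunsetCellBundle.bSℝ_fin b 1
  have e2 : b.bSℝ 2 = ((b.bS 2 : ℚ) : ℝ) := SunsetCellBundle.bSℝ_fin b 2
  obtain ⟨g1, g2⟩ := hB b hb
  exact twoLegRead_frameZero_dedicated_of_records_certA (L := L) (M := M) hA hβ hμ hU hUb hL3 hM hSk (hSjetW μ U β L M hμ hU hUb hβ hL3 hM)
    (by rw [e1]; exact g1) (by rw [e2]; exact g2)

end Summit.HubbardSuperconductivity.HubbardSuperconductivity.Theorems.KLRegimeSplit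

end
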